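import Literature.Analysis.OperatorTheory.Enflo2023.Basic
import HarnessLib

/-!
# Enflo 2023: the standard WLOG reductions (kernel, dense range, separability, eigenvectors, adjoint)

Source under adjudication: Per H. Enflo, *On the invariant subspace problem in Hilbert spaces*, arXiv:2305.15442 (v1
2023, v2 2024), bib key `Enflo2023` — a CLAIMED proof of the invariant subspace problem for operators on a separable
Hilbert space.  This file is part of the kernel-tight typing of the manuscript by the b2b-enflo repair cell
(formaliser 2, Part B: (28)–(47), the limiting argument and the final deduction).  It records what FOLLOWS (proved
implications from the manuscript's displayed hypotheses) and, where a step does not follow, the typed inference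
together with its refutation.  NOTHING here asserts that the manuscript's main theorem holds; no declaration concludes
the invariant subspace problem for an arbitrary operator.  Value (BLOCK-2b): theorems / refutations of typed
inferences about a text — not progress on the problem.

EnfloISP — Part B (formaliser 2).  REDUCTIONS and REPAIR-CENSUS rows that CLOSE in Lean (zero sorry):
* the paper's standing WLOG (v2 p.2): `T` one-to-one and `R(T)` dense — otherwise `ker T` resp. `closure R(T)`
  is a non-trivial closed invariant subspace (given `T ≠ 0`, `dim H ≥ 2` for the kernel case);
* non-separable `H`: every orbit closure is separable, so every non-zero vector is non-cyclic — the ISP is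
  trivial there (this is why the weak-compactness lemma may assume separability);
* an eigenvector gives an invariant subspace; hence the FINITE-DIMENSIONAL case (dim ≥ 2) of the theorem closes
  (census row V-findim) — note the gap inference `RoomClaim` is false even in dimension 4 (Gap.lean), so the
  gap is in the proof, not in these cases of the theorem;
* invariant subspaces transfer from `T†` to `T` by orthogonal complement (used to repair the tacit
  "T^{*m} q(T^*) y₀' near x₀" on v2 p.21: either those vectors are dense or `T†`, hence `T`, already has one).
-/

open scoped InnerProductSpace
open Filter Topology Submodule TopologicalSpace

namespace Literature.Analysis.OperatorTheory.Enflo2023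

variable {H : Type*} [NormedAddCommGroup H] [InnerProductSpace ℂ H]

/-! ### WLOG: kernel and range -/

/-- If `T` is not injective and `T ≠ 0`, then `ker T` is a non-trivial closed invariant subspace. [folklore] -/
theorem hasNontrivialClosedInvariantSubspace_of_not_injective (T : H →L[ℂ] H)
    (hT : ¬ Function.Injective T) (hT0 : T ≠ 0) : HasNontrivialClosedInvariantSubspace T := by
  refine ⟨LinearMap.ker (T : H →ₗ[ℂ] H), T.isClosed_ker, ?_, ?_, ?_⟩
  · rwa [ne_eq, LinearMap.ker_eq_bot]
  · intro htop
    apply hT0; ext x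
    have hx : x ∈ LinearMap.ker (T : H →ₗ[ℂ] H) := htop ▸ Submodule.mem_top
    simpa using hx
  · intro x hx
    simp only [LinearMap.mem_ker, ContinuousLinearMap.coe_coe] at hx ⊢
    rw [hx, map_zero]

/-- If the range of `T` is not dense and `T ≠ 0`, its closure is a non-trivial closed invariant subspace. [folklore] -/
theorem hasNontrivialClosedInvariantSubspace_of_range_not_dense (T : H →L[ℂ] H)
    (hT : (LinearMap.range (T : H →ₗ[ℂ] H)).topologicalClosure ≠ ⊤) (hT0 : T ≠ 0) :
    HasNontrivialClosedInvariantSubspace T := by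
  refine ⟨(LinearMap.range (T : H →ₗ[ℂ] H)).topologicalClosure, Submodule.isClosed_topologicalClosure _,
    ?_, hT, ?_⟩
  · intro hbot
    apply hT0; ext x
    have hx : T x ∈ (LinearMap.range (T : H →ₗ[ℂ] H)).topologicalClosure :=
      Submodule.le_topologicalClosure _ ⟨x, rfl⟩
    rw [hbot, Submodule.mem_bot] at hx
    simpa using hx
  · intro x _
    exact Submodule.le_topologicalClosure _ ⟨x, rfl⟩

/-! ### Non-separable spaces -/

omit [InnerProductSpace ℂ H] in
/-- The orbit `{T^j y}` of a single vector has separable closed span. [folklore] -/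
lemma isSeparable_range_pow [Module ℂ H] [ContinuousAdd H] [ContinuousSMul ℂ H] (T : H →L[ℂ] H) (y : H) :
    TopologicalSpace.IsSeparable
      ((Submodule.span ℂ (Set.range fun j : ℕ => (T ^ j) y)).topologicalClosure : Set H) := by
  rw [Submodule.topologicalClosure_coe, TopologicalSpace.isSeparable_closure]
  exact (Set.countable_range _).isSeparable.span

/-- In a NON-separable Hilbert space every orbit closure is a proper subspace: every non-zero vector is
non-cyclic, and the ISP is trivial.  (So `SeparableSpace H` may be assumed where weak compactness is used.) [folklore] -/
theorem isNonCyclic_of_not_separable (hH : ¬ SeparableSpace H) (T : H →L[ℂ] H) (y : H) :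
    IsNonCyclic T y := by
  intro htop
  apply hH
  rw [← TopologicalSpace.isSeparable_univ_iff]
  have h := isSeparable_range_pow T y
  unfold orbitClosure at htop
  rwa [htop, Submodule.top_coe] at h

/-- WLOG separable (v2 p.2): on a non-separable space every orbit closure is a non-trivial closed invariant subspace. [folklore] -/
theorem hasNontrivialClosedInvariantSubspace_of_not_separable [Nontrivial H] (hH : ¬ SeparableSpace H)
    (T : H →L[ℂ] H) : HasNontrivialClosedInvariantSubspace T := by
  obtain ⟨y, hy⟩ := exists_ne (0 : H)
  exact hasNontrivialClosedInvariantSubspace_of_isNonCyclic T hy (isNonCyclic_of_not_separable hH T y)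

/-! ### Eigenvectors; the finite-dimensional case -/

/-- An eigenvector spans a (closed, one-dimensional) invariant subspace; it is non-trivial as soon as `H` is
not spanned by it, e.g. `2 ≤ dim H`. [folklore] -/
theorem hasNontrivialClosedInvariantSubspace_of_eigenvector (T : H →L[ℂ] H) {v : H} {μ : ℂ} (hv : v ≠ 0)
    (hTv : T v = μ • v) (hspan : (ℂ ∙ v) ≠ ⊤) : HasNontrivialClosedInvariantSubspace T := by
  refine ⟨ℂ ∙ v, ?_, ?_, hspan, ?_⟩
  · exact (ℂ ∙ v).closed_of_finiteDimensional
  · rw [ne_eq, Submodule.span_singleton_eq_bot]; exact hv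
  · intro x hx
    rw [Submodule.mem_span_singleton] at hx ⊢
    obtain ⟨a, rfl⟩ := hx
    exact ⟨a * μ, by rw [map_smul, hTv, smul_smul]⟩

/-- CENSUS ROW V-findim: in finite dimension `≥ 2` every operator has a non-trivial (closed) invariant
subspace (an eigenline).  The theorem holds here although the gap inference is false in dimension 4. [folklore] -/
theorem hasNontrivialClosedInvariantSubspace_of_finiteDimensional [FiniteDimensional ℂ H]
    (h2 : 2 ≤ Module.finrank ℂ H) (T : H →L[ℂ] H) : HasNontrivialClosedInvariantSubspace T := by
  have : Nontrivial H := Module.nontrivial_of_finrank_pos (R := ℂ) (by omega)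
  obtain ⟨μ, hμ⟩ := Module.End.exists_eigenvalue (T : H →ₗ[ℂ] H)
  obtain ⟨v, hv⟩ := hμ.exists_hasEigenvector
  refine hasNontrivialClosedInvariantSubspace_of_eigenvector T (μ := μ) hv.2 ?_ ?_
  · simpa using hv.apply_eq_smul
  · intro htop
    have h1 : Module.finrank ℂ (ℂ ∙ v) = 1 := finrank_span_singleton hv.2
    rw [htop, finrank_top] at h1
    omega

/-! ### From `T†` to `T` -/

/-- If `M` is invariant under the adjoint `T†`, then `Mᗮ` is invariant under `T`. [folklore] -/
lemma isInvariant_orthogonal_of_adjoint [CompleteSpace H] (T : H →L[ℂ] H) {M : Submodule ℂ H}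
    (hM : IsInvariant (ContinuousLinearMap.adjoint T) M) : IsInvariant T Mᗮ := by
  intro x hx
  rw [Submodule.mem_orthogonal] at hx ⊢
  intro u hu
  rw [← ContinuousLinearMap.adjoint_inner_left]
  exact hx _ (hM u hu)

/-- A non-trivial closed invariant subspace of `T†` yields one for `T` (its orthogonal complement). [folklore] -/
theorem hasNontrivialClosedInvariantSubspace_of_adjoint [CompleteSpace H] (T : H →L[ℂ] H)
    (h : HasNontrivialClosedInvariantSubspace (ContinuousLinearMap.adjoint T)) :
    HasNontrivialClosedInvariantSubspace T := by
  obtain ⟨M, hMc, hMb, hMt, hMi⟩ := h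
  have hMM : Mᗮᗮ = M := by
    have : CompleteSpace M := hMc.completeSpace_coe
    exact Submodule.orthogonal_orthogonal M
  refine ⟨Mᗮ, Submodule.isClosed_orthogonal M, ?_, ?_, isInvariant_orthogonal_of_adjoint T hMi⟩
  · intro hb; apply hMt
    rw [← hMM, hb, Submodule.bot_orthogonal_eq_top]
  · intro ht; apply hMb
    rw [← hMM, ht, Submodule.top_orthogonal_eq_bot]

end Literature.Analysis.OperatorTheory.Enflo2023
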